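import Mathlib
import Literature.MathematicalPhysics.QuantumFieldTheory.Balaban1983to89.Beta.OneLoop

/-!
# Beta/WardIdentity — the Hessian of an invariant function at an invariant critical point annihilates the
symmetry generators (Lemma W of the β sub-cell row an2; the mechanism behind the Ward–Takahashi identity (5.9))

HONEST FRAMING (cell `pub-balaban`, β sub-cell; HOME/BETA/AN2.md §0 and §8.7, BETA-SPEC §7–§8).  The β sub-cell tries
to discharge the one-loop input of [Balaban1987RG1] Theorem 2 (`FlowStep.BetaPertH`, read in the drift form of
`Beta/Assembly`); doing so would make Bałaban's ultraviolet STABILITY theorem unconditional — it is NOT the continuum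
limit and NOT the Clay problem, and this module is not even that: it is the two-line calculus lemma that turns
GAUGE INVARIANCE of a piece of the effective action plus CRITICALITY at zero field into the exact finite-volume
Ward identity for that piece's polarization Hessian (row an2's (H1-W), "Ward identity per invariant piece").  NOTHING
about Bałaban's actual functionals is asserted here: invariance, criticality and regularity are HYPOTHESES, to be
supplied piece by piece by the analysis (AN2.md §8.7 (W-a)–(W-d): invariance from the printed covariances
[Balaban1985BackgroundPropagators] (3.28)–(3.32) p. 395 and «All these inequalities are invariant with respect to gauge
transformations of U» p. 398, plus the minimiser's orbit covariance [Balaban1987RG1] (2.16)–(2.18) p. 269; criticality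
from the centre argument; regularity in finite volume).  Value = kernel certificate of an elementary step, NOT summit
progress.

PRINTED CONTEXT.  [Balaban1987RG1] p. 293, (5.9): the Ward–Takahashi identity for the scale-`j` polarization tensor,
derived there from the gauge invariance of the effective action; row an2 needs it for EVERY gauge-invariant summand of
the composed one-loop functional separately (bulk log-determinant, unit-lattice factor, ghost determinant, local
Jacobians — AN2.md §8.6 (S′-exact)), because the KKT / gauge-fixing split distributes the marginal logarithm over
pieces whose individual second moments are of mass-term size unless each piece obeys the identity (lead's BETA-SPEC
v1.8 §8.6 (L3)).  The printed finite-dimensional precedent is Goldstone's lemma for a LINEAR symmetry action,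
[ChengLi1984] (8.121)–(8.123): «∂V/∂φ_i T^a_{ij}φ_j = 0», differentiate, «∂²V/∂φ_i∂φ_k T^a_{ij}φ_j + ∂V/∂φ_i T^a_{ik} = 0»,
and at a stationary point «∂²V/∂φ_i∂φ_k|_{φ=v} T^a_{ij}v_j = 0».  The version below allows a NONLINEAR action (the
generator is an arbitrary vector field `X`, differentiable at `0`, along which `f` is infinitesimally invariant near
`0`): differentiate `B ↦ Df(B)[X(B)] ≡ 0` at `0` and use `Df(0) = 0`.  This is what the gauge group acting on external
fields `B` through `e^{iB} ↦ (e^{iB})^{u}` requires — the action is nonlinear in `B`.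

WHAT IS PROVED (all `[folklore]`):
* `fderiv_apply_eq_zero_of_const_along` — if `f` is constant along a curve through `B` with velocity `v` then
  `Df(B) v = 0` (how infinitesimal invariance is obtained from invariance under a one-parameter family);
* `sndFDeriv_apply_generator_eq_zero` — LEMMA W: `f` is `C²` at `0`, `X` differentiable at `0`,
  `Df(B)[X(B)] = 0` for `B` near `0`, `Df(0) = 0` ⇒ `D²f(0)(v, X 0) = 0` for every `v`; and the other slot
  `sndFDeriv_generator_apply_eq_zero` by the symmetry of second derivatives over `ℝ`;
* `hessian_of_flow_invariant` — the packaged form from a one-parameter family `Φ t` of maps fixing `f` with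
  `Φ 0 = id` and `∂ₜΦ t B|₀ = X B`;
* `hessianAt_sum_generator_eq_zero` / `hessianAt_generator_sum_eq_zero` — the coordinate form for the cell's
  `Beta.hessianAt` (the operation (1.20) of [Balaban1987RG1] on functions of the external field):
  `Σ_j hessianAt f i j · (X 0) j = 0` and `Σ_i (X 0) i · hessianAt f i j = 0` — the shape of (5.9) summed against a
  pure-gauge external field `X 0 = ∂λ`.
* (v1.1, adv2-g10) `constrained_sndFDeriv_generator_eq_zero` — LEMMA W WITH A LAGRANGE MULTIPLIER: `f`, `Φ` both
  infinitesimally invariant along `X` near `0` (on the WHOLE space, not only on the constraint surface), `Df(0) = μ∘DΦ(0)`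
  ⇒ `D²f(0)(v, X 0) − μ(D²Φ(0)(v, X 0)) = 0` for EVERY `v`.  This is the STRONG form of `Beta.GaugeFixing`'s clause (c1)
  (`K W = 0` as an operator identity) for the intrinsic constrained Hessian `Δ₁ = D²𝒜 − μ∘D²Φ` ([Balaban1987RG1] (2.7),
  [Balaban1985BackgroundPropagators] (3.134)): AN2.md §8.7 Lemma IH (b) yields only its restriction to `v ∈ ker DΦ(0)`
  (`Δ₁ W ∈ range Qᵀ`), which is NOT (c1) — the `example` `weak_form_not_c1` exhibits a symmetric `K`, a constraint `Q` and a
  direction `w` with `⟨K w, v⟩ = 0` on `ker Q` but `K w ≠ 0`.  The strong form needs the invariance of `Φ` (the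
  averaging) under the residual directions EVERYWHERE, which is what [Balaban1987RG1] (2.16)–(2.18) p. 269 give at
  `ū = 1` (GAPS G-adv2-22);
* (v1.1.1, an2-g2, DOCFIX) locator only: [Balaban1987RG1] (2.16)–(2.18) are printed on p. 269 [PDF 21] of CMP 109
  (the two occurrences above read «p. 267» in v1/v1.1; REFEREE5.md #25, GAPS C-ref5-25); no declaration touched;
WHAT IS NOT PROVED: that any of Bałaban's pieces satisfies the hypotheses (analysis, AN2.md §8.7); any sign or value
of a coefficient; transversality of the `p²`-term; anything about `k → ∞` or the infinite-volume limit.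
-/

namespace Literature.MathematicalPhysics.QuantumFieldTheory.Balaban1983to89.Beta.WardIdentity

open Literature.MathematicalPhysics.QuantumFieldTheory.Balaban1983to89
open Filter Topology

section Abstract

variable {E : Type*} [NormedAddCommGroup E] [NormedSpace ℝ E]

/-- Infinitesimal invariance from invariance along a curve: if `f` is differentiable at `B` and constant along a
curve `γ` with `γ 0 = B`, `γ'(0) = v`, then `Df(B) v = 0`. [folklore] -/
theorem fderiv_apply_eq_zero_of_const_along {f : E → ℝ} {B v : E} {γ : ℝ → E}
    (hγ0 : γ 0 = B) (hγ : HasDerivAt γ v 0) (hfd : DifferentiableAt ℝ f B)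
    (hconst : ∀ t, f (γ t) = f B) : fderiv ℝ f B v = 0 := by
  have hf' : HasFDerivAt f (fderiv ℝ f B) (γ 0) := by
    rw [hγ0]; exact hfd.hasFDerivAt
  have h1 : HasDerivAt (f ∘ γ) (fderiv ℝ f B v) 0 := hf'.comp_hasDerivAt 0 hγ
  have h2 : HasDerivAt (f ∘ γ) 0 0 := by
    have : (f ∘ γ) = fun _ => f B := funext fun t => hconst t
    rw [this]; exact hasDerivAt_const 0 (f B)
  exact h1.unique h2

/-- LEMMA W (nonlinear Goldstone lemma; AN2.md §8.7).  If `f` is `C²` at `0`, the vector field `X` is differentiable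
at `0`, `f` is infinitesimally invariant along `X` near `0` (`Df(B)[X(B)] = 0`) and `0` is a critical point, then the
Hessian at `0` annihilates the generator `X 0` in its second slot: `D²f(0)(v, X 0) = 0`.  Proof: differentiate the
identically vanishing function `B ↦ Df(B)[X(B)]` at `0` by the product rule and use `Df(0) = 0`.
[cite: ChengLi1984, (8.121)–(8.123) (linear action); folklore for the nonlinear action] -/
theorem sndFDeriv_apply_generator_eq_zero {f : E → ℝ} {X : E → E}
    (hf : ContDiffAt ℝ 2 f 0) (hX : DifferentiableAt ℝ X 0)
    (hinv : ∀ᶠ B in 𝓝 (0 : E), fderiv ℝ f B (X B) = 0) (hcrit : fderiv ℝ f 0 = 0) (v : E) :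
    fderiv ℝ (fderiv ℝ f) 0 v (X 0) = 0 := by
  have hc : DifferentiableAt ℝ (fderiv ℝ f) 0 :=
    (hf.fderiv_right (m := 1) le_rfl).differentiableAt (by simp)
  have h1 : fderiv ℝ (fun B => fderiv ℝ f B (X B)) 0 = 0 := by
    have hEq : (fun B => fderiv ℝ f B (X B)) =ᶠ[𝓝 (0 : E)] fun _ => (0 : ℝ) := hinv
    rw [hEq.fderiv_eq]
    simp
  have h2 : fderiv ℝ (fun B => fderiv ℝ f B (X B)) 0 =
      (fderiv ℝ f 0).comp (fderiv ℝ X 0) + (fderiv ℝ (fderiv ℝ f) 0).flip (X 0) :=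
    fderiv_clm_apply hc hX
  have h3 := congrArg (fun L : E →L[ℝ] ℝ => L v) (h1.symm.trans h2)
  simpa [hcrit] using h3.symm

/-- LEMMA W, first slot: under the same hypotheses `D²f(0)(X 0, v) = 0`, by the symmetry of the second derivative of a
`C²` function over `ℝ`. [folklore] -/
theorem sndFDeriv_generator_apply_eq_zero {f : E → ℝ} {X : E → E}
    (hf : ContDiffAt ℝ 2 f 0) (hX : DifferentiableAt ℝ X 0)
    (hinv : ∀ᶠ B in 𝓝 (0 : E), fderiv ℝ f B (X B) = 0) (hcrit : fderiv ℝ f 0 = 0) (v : E) :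
    fderiv ℝ (fderiv ℝ f) 0 (X 0) v = 0 := by
  have hs : IsSymmSndFDerivAt ℝ f 0 := hf.isSymmSndFDerivAt (by simp)
  rw [hs.eq]
  exact sndFDeriv_apply_generator_eq_zero hf hX hinv hcrit v

/-- LEMMA W with GLOBAL infinitesimal invariance (the finite-volume situation of AN2.md §8.7, where the gauge group
acts everywhere). [folklore] -/
theorem sndFDeriv_apply_generator_eq_zero' {f : E → ℝ} {X : E → E}
    (hf : ContDiffAt ℝ 2 f 0) (hX : DifferentiableAt ℝ X 0)
    (hinv : ∀ B, fderiv ℝ f B (X B) = 0) (hcrit : fderiv ℝ f 0 = 0) (v : E) :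
    fderiv ℝ (fderiv ℝ f) 0 v (X 0) = 0 ∧ fderiv ℝ (fderiv ℝ f) 0 (X 0) v = 0 :=
  ⟨sndFDeriv_apply_generator_eq_zero hf hX (Eventually.of_forall hinv) hcrit v,
   sndFDeriv_generator_apply_eq_zero hf hX (Eventually.of_forall hinv) hcrit v⟩

/-- PACKAGED FORM from a one-parameter family of symmetries (the shape in which invariance is printed:
[Balaban1985BackgroundPropagators] (3.28)–(3.32), [Balaban1987RG1] (2.16)–(2.18)).  `Φ t` are maps `E → E` with
`Φ 0 B = B`, `t ↦ Φ t B` differentiable at `0` with velocity `X B`, `f ∘ Φ t = f` for all `t`; `f` is `C²` at `0`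
and differentiable near `0`; `X` is differentiable at `0`; `Df(0) = 0`.  Then the Hessian of `f` at `0` annihilates
`X 0` in both slots. [folklore] -/
theorem hessian_of_flow_invariant {f : E → ℝ} {X : E → E} (Φ : ℝ → E → E)
    (hΦ0 : ∀ B, Φ 0 B = B) (hΦd : ∀ B, HasDerivAt (fun t => Φ t B) (X B) 0)
    (hinv : ∀ t B, f (Φ t B) = f B)
    (hf : ContDiffAt ℝ 2 f 0) (hfd : ∀ᶠ B in 𝓝 (0 : E), DifferentiableAt ℝ f B)
    (hX : DifferentiableAt ℝ X 0) (hcrit : fderiv ℝ f 0 = 0) (v : E) :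
    fderiv ℝ (fderiv ℝ f) 0 v (X 0) = 0 ∧ fderiv ℝ (fderiv ℝ f) 0 (X 0) v = 0 := by
  have hinv' : ∀ᶠ B in 𝓝 (0 : E), fderiv ℝ f B (X B) = 0 := by
    filter_upwards [hfd] with B hB
    exact fderiv_apply_eq_zero_of_const_along (γ := fun t => Φ t B) (hΦ0 B) (hΦd B) hB (fun t => hinv t B)
  exact ⟨sndFDeriv_apply_generator_eq_zero hf hX hinv' hcrit v,
    sndFDeriv_generator_apply_eq_zero hf hX hinv' hcrit v⟩

/-- A `C²`-at-`0` function is differentiable near `0` (so `hfd` of `hessian_of_flow_invariant` follows from `hf`).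
[folklore] -/
theorem eventually_differentiableAt_of_contDiffAt_two {f : E → ℝ} (hf : ContDiffAt ℝ 2 f 0) :
    ∀ᶠ B in 𝓝 (0 : E), DifferentiableAt ℝ f B := by
  filter_upwards [hf.eventually (by simp)] with B hB
  exact hB.differentiableAt (by simp)

end Abstract

/-! ## Coordinate form for `Beta.hessianAt` ((1.20) as an operation on functions of the external field) -/

section Coordinates

variable {ι : Type*} [Fintype ι] [DecidableEq ι]

/-- `hessianAt f i j` is the second derivative on the coordinate vectors. [folklore] -/
theorem hessianAt_eq_fderiv_fderiv (f : (ι → ℝ) → ℝ) (i j : ι) :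
    Beta.hessianAt f i j = fderiv ℝ (fderiv ℝ f) 0 (Pi.single i 1) (Pi.single j 1) := by
  unfold Beta.hessianAt
  rw [iteratedFDeriv_two_apply]
  rfl

/-- Expansion of a vector in the coordinate basis with `Pi.single · 1`. [folklore] -/
theorem sum_smul_single_one (ξ : ι → ℝ) : ∑ j, ξ j • (Pi.single j (1 : ℝ) : ι → ℝ) = ξ := by
  have : ∀ j, ξ j • (Pi.single j (1 : ℝ) : ι → ℝ) = Pi.single j (ξ j) := by
    intro j; ext k; by_cases h : k = j
    · subst h; simp
    · simp [h]
  simp_rw [this]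
  exact Finset.univ_sum_single ξ

/-- WARD IDENTITY IN COORDINATES, second slot: under the hypotheses of Lemma W,
`Σ_j hessianAt f i j · (X 0) j = 0` for every `i` — the shape of [Balaban1987RG1] (5.9) p. 293 summed against the
pure-gauge field `X 0 = ∂λ` (AN2.md §8.7: `Σ_{b′} Π^P(b,b′)(∂λ)(b′) = 0`). [cite: Balaban1987RG1, (5.9) p.293] -/
theorem hessianAt_sum_generator_eq_zero {f : (ι → ℝ) → ℝ} {X : (ι → ℝ) → (ι → ℝ)}
    (hf : ContDiffAt ℝ 2 f 0) (hX : DifferentiableAt ℝ X 0)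
    (hinv : ∀ᶠ B in 𝓝 (0 : ι → ℝ), fderiv ℝ f B (X B) = 0) (hcrit : fderiv ℝ f 0 = 0) (i : ι) :
    ∑ j, Beta.hessianAt f i j * (X 0) j = 0 := by
  have key := sndFDeriv_apply_generator_eq_zero hf hX hinv hcrit (Pi.single i 1)
  set L : (ι → ℝ) →L[ℝ] ℝ := fderiv ℝ (fderiv ℝ f) 0 (Pi.single i 1) with hL
  have hsum : ∑ j, Beta.hessianAt f i j * (X 0) j = L (∑ j, (X 0) j • (Pi.single j (1 : ℝ) : ι → ℝ)) := by
    rw [map_sum]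
    refine Finset.sum_congr rfl fun j _ => ?_
    rw [map_smul, hessianAt_eq_fderiv_fderiv, smul_eq_mul, mul_comm]
  rw [hsum, sum_smul_single_one]
  exact key

/-- WARD IDENTITY IN COORDINATES, first slot: `Σ_i (X 0) i · hessianAt f i j = 0` for every `j`.
[cite: Balaban1987RG1, (5.9) p.293] -/
theorem hessianAt_generator_sum_eq_zero {f : (ι → ℝ) → ℝ} {X : (ι → ℝ) → (ι → ℝ)}
    (hf : ContDiffAt ℝ 2 f 0) (hX : DifferentiableAt ℝ X 0)
    (hinv : ∀ᶠ B in 𝓝 (0 : ι → ℝ), fderiv ℝ f B (X B) = 0) (hcrit : fderiv ℝ f 0 = 0) (j : ι) :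
    ∑ i, (X 0) i * Beta.hessianAt f i j = 0 := by
  have hs : IsSymmSndFDerivAt ℝ f 0 := hf.isSymmSndFDerivAt (by simp)
  have hsym : ∀ i, Beta.hessianAt f i j = Beta.hessianAt f j i := by
    intro i; rw [hessianAt_eq_fderiv_fderiv, hessianAt_eq_fderiv_fderiv, hs.eq]
  simp_rw [hsym, mul_comm ((X 0) _)]
  exact hessianAt_sum_generator_eq_zero hf hX hinv hcrit j

/-- NON-VACUITY: the hypotheses are satisfiable non-trivially — `f B = (B 0 - B 1)^2` on `Fin 2 → ℝ` is invariant under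
the translations `B ↦ B + t·(1,1)` (generator `X ≡ (1,1)`), critical at `0` (a minimum), and the generator is non-zero;
infinitesimal invariance is obtained through `fderiv_apply_eq_zero_of_const_along`, criticality through
`IsLocalMin.fderiv_eq_zero`. [folklore] -/
example : ∃ (f : (Fin 2 → ℝ) → ℝ) (X : (Fin 2 → ℝ) → (Fin 2 → ℝ)),
    ContDiffAt ℝ 2 f 0 ∧ DifferentiableAt ℝ X 0 ∧ (∀ B, fderiv ℝ f B (X B) = 0) ∧ fderiv ℝ f 0 = 0 ∧
    X 0 ≠ 0 := by
  refine ⟨fun B => (B 0 - B 1) ^ 2, fun _ => fun _ => 1, ?_, ?_, ?_, ?_, ?_⟩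
  · have h : ContDiff ℝ 2 (fun B : Fin 2 → ℝ => (B 0 - B 1) ^ 2) := by fun_prop
    exact h.contDiffAt
  · exact differentiableAt_const _
  · intro B
    have hγ : HasDerivAt (fun t : ℝ => B + t • (fun _ : Fin 2 => (1 : ℝ))) (fun _ : Fin 2 => (1 : ℝ)) 0 := by
      simpa using ((hasDerivAt_id (0 : ℝ)).smul_const (fun _ : Fin 2 => (1 : ℝ))).const_add B
    refine fderiv_apply_eq_zero_of_const_along (γ := fun t : ℝ => B + t • (fun _ : Fin 2 => (1 : ℝ)))
      (by simp) hγ (by fun_prop) ?_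
    intro t
    simp
  · refine IsLocalMin.fderiv_eq_zero ?_
    refine Filter.Eventually.of_forall fun B => ?_
    simpa using sq_nonneg (B 0 - B 1)
  · intro h
    have := congrFun h 0
    simp at this

end Coordinates

/-! ## Lemma W with a Lagrange multiplier (v1.1, adv2-g10; GAPS G-adv2-22) -/

section Constrained

variable {E F : Type*} [NormedAddCommGroup E] [NormedSpace ℝ E] [NormedAddCommGroup F] [NormedSpace ℝ F]

/-- LEMMA W WITH A LAGRANGE MULTIPLIER (strong form of `Beta.GaugeFixing` (c1) for the intrinsic constrained Hessian).
`f : E → ℝ` and `Φ : E → F` are `C²` at `0`, the vector field `X` is differentiable at `0`, BOTH `f` and `Φ` are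
infinitesimally invariant along `X` near `0` (`Df(B)[X(B)] = 0`, `DΦ(B)[X(B)] = 0` — everywhere near `0`, not only on
`Φ⁻¹(v)`), and `0` is constrained-critical with multiplier `μ` (`Df(0) = μ ∘ DΦ(0)`).  Then the multiplier-corrected
Hessian annihilates `X 0` against EVERY `v` (not only `v ∈ ker DΦ(0)`):
`D²f(0)(v, X 0) − μ(D²Φ(0)(v, X 0)) = 0`.  Proof: differentiate the two identically vanishing functions
`B ↦ Df(B)[X(B)]` and `B ↦ DΦ(B)[X(B)]` at `0`; the two `DX`-terms cancel by the multiplier relation.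
Dictionary (AN2.md §8.7): `f` = Wilson action, `Φ` = the `n`-fold averaging, `X U = D_U λ` (`λ` in the residual
algebra), `Df(0) = ⟨·, J⟩ = μ∘DΦ(0)`, `D²f − μ∘D²Φ` = `Δ − Δ^{(2)} = Δ₁` of [Balaban1987RG1] (2.7). [folklore] -/
theorem constrained_sndFDeriv_generator_eq_zero {f : E → ℝ} {Φ : E → F} {μ : F →L[ℝ] ℝ} {X : E → E}
    (hf : ContDiffAt ℝ 2 f 0) (hΦ : ContDiffAt ℝ 2 Φ 0) (hX : DifferentiableAt ℝ X 0)
    (hinvf : ∀ᶠ B in 𝓝 (0 : E), fderiv ℝ f B (X B) = 0)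
    (hinvΦ : ∀ᶠ B in 𝓝 (0 : E), fderiv ℝ Φ B (X B) = 0)
    (hcrit : fderiv ℝ f 0 = μ.comp (fderiv ℝ Φ 0)) (v : E) :
    fderiv ℝ (fderiv ℝ f) 0 v (X 0) - μ (fderiv ℝ (fderiv ℝ Φ) 0 v (X 0)) = 0 := by
  have hcf : DifferentiableAt ℝ (fderiv ℝ f) 0 :=
    (hf.fderiv_right (m := 1) le_rfl).differentiableAt (by simp)
  have hcΦ : DifferentiableAt ℝ (fderiv ℝ Φ) 0 :=
    (hΦ.fderiv_right (m := 1) le_rfl).differentiableAt (by simp)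
  have h1 : fderiv ℝ (fun B => fderiv ℝ f B (X B)) 0 = 0 := by
    have hEq : (fun B => fderiv ℝ f B (X B)) =ᶠ[𝓝 (0 : E)] fun _ => (0 : ℝ) := hinvf
    rw [hEq.fderiv_eq]; simp
  have h1Φ : fderiv ℝ (fun B => fderiv ℝ Φ B (X B)) 0 = 0 := by
    have hEq : (fun B => fderiv ℝ Φ B (X B)) =ᶠ[𝓝 (0 : E)] fun _ => (0 : F) := hinvΦ
    rw [hEq.fderiv_eq]; simp
  have h2 : fderiv ℝ (fun B => fderiv ℝ f B (X B)) 0 =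
      (fderiv ℝ f 0).comp (fderiv ℝ X 0) + (fderiv ℝ (fderiv ℝ f) 0).flip (X 0) :=
    fderiv_clm_apply hcf hX
  have h2Φ : fderiv ℝ (fun B => fderiv ℝ Φ B (X B)) 0 =
      (fderiv ℝ Φ 0).comp (fderiv ℝ X 0) + (fderiv ℝ (fderiv ℝ Φ) 0).flip (X 0) :=
    fderiv_clm_apply hcΦ hX
  have h3 := congrArg (fun L : E →L[ℝ] ℝ => L v) (h1.symm.trans h2)
  have h3Φ := congrArg (fun L : E →L[ℝ] F => μ (L v)) (h1Φ.symm.trans h2Φ)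
  simp only [add_apply, ContinuousLinearMap.comp_apply,
    ContinuousLinearMap.flip_apply, zero_apply, map_zero, map_add] at h3 h3Φ
  rw [hcrit] at h3
  simp only [ContinuousLinearMap.comp_apply] at h3
  linarith

/-- THE WEAK FORM IS NOT (c1): a symmetric `K`, a constraint `Q` and a direction `w` with `Q w = 0`,
`⟨v, K w⟩ = 0` for every `v ∈ ker Q`, and yet `K w ≠ 0` — so a discharge of `Beta.GaugeFixing.logZ_slice_change`'s
hypothesis `K * W = 0` from Lemma IH (b) alone (annihilation on the tangent space of the constraint surface) is a
non sequitur; the strong form above, or `det kkt`-invariance under `K ↦ K + Qᵀ N + Nᵀ Q`, is required. [folklore] -/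
theorem weak_form_not_c1 : ∃ (K : Matrix (Fin 2) (Fin 2) ℝ) (Q : Matrix (Fin 1) (Fin 2) ℝ) (w : Fin 2 → ℝ),
    K.IsSymm ∧ Q.mulVec w = 0 ∧ (∀ v, Q.mulVec v = 0 → dotProduct v (K.mulVec w) = 0) ∧ K.mulVec w ≠ 0 := by
  refine ⟨!![0, 1; 1, 0], !![0, 1], ![1, 0], ?_, ?_, ?_, ?_⟩
  · ext i j; fin_cases i <;> fin_cases j <;> rfl
  · ext i; fin_cases i; simp [Matrix.mulVec, dotProduct]
  · intro v hv
    have h1 : v 1 = 0 := by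
      have := congrFun hv 0
      simp [Matrix.mulVec, dotProduct] at this
      exact this
    simp [Matrix.mulVec, dotProduct, Fin.sum_univ_two, h1]
  · intro h
    have := congrFun h 1
    simp [Matrix.mulVec, dotProduct] at this

end Constrained

end Literature.MathematicalPhysics.QuantumFieldTheory.Balaban1983to89.Beta.WardIdentity
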